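import Summits.Ventures.Crystal3D.Theorems.StickyWulffConstantGenericWallFloorLineCountUpper
import Summits.Ventures.Crystal3D.Theorems.StickyWulffConstantTextureLiminfTexShadowSweptEllipseCount
import Mathlib.LinearAlgebra.CrossProduct
import HarnessLib

/-!
# Bond lines of one class through a slab sample: a count UNIFORM in the orientation

HONEST FRAMING. Part of the venture `Summits/Ventures/Crystal3D` (cell `crystal3d-full`), helper for the
crux `TextureLiminf` (stmt-Ventures-19483) of `route-Ventures-StickyWulffConstant`, line `TexShadow`, item n0
(`affineSampleDeficit_upper_unif`).  The existing per-class count `lineCount_upper_offset_window` bounds the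
number of lines `{a Ea + b Eb + t W + s : t ∈ ℤ}` (`(a, b) ∈ T ⊆ ℤ²`) meeting the slab sample
`{x : lo ≤ ⟪x, ν⟫ ≤ lo + R, ‖x‖² - ⟪x, ν⟫² ≤ ρ²}` by `√2 |α| π (ρ + (R/2 + 4)/|α|)²`, `α = ⟪W, ν⟫`: sharp in
the leading term but with a remainder `∝ 1/|α|`, useless for grains of arbitrary orientation.

**Theorem** (`lineCount_upper_uniform`).  Under the same hypotheses,
`#T ≤ √2 |α| π (ρ + 2)² + 2 √2 π (ρ + R + 4)(R + 4)`.

Proof.  Project each line orthogonally onto `W^⊥`, with the orthonormal frame `B₁ = (ν - α W)/s'`,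
`B₀ = B₁ × W`, `s' = √(1 - α²)` (when `α² < 1`).  The feet form the affine lattice
`(a, b) ↦ (⟪·, B₀⟫, ⟪·, B₁⟫)` of determinant `det[Ea, Eb, W] = ±1/√2`; a whole cell `(a, b) + [0,1)²` is the
set of feet of the points `x + f₀ Ea + f₁ Eb`, which lie in the enlarged sample `(ρ + 2, lo - 2, R + 4)`; and
the foot `y` of a point `x` of a sample with parameters `(ρ', lo', R')` satisfies
`α² y₀² + (y₁ - h s')² = α² (⟪x, B₀⟫² + ⟪x, G⟫²) ≤ α² ρ'²` with `h = ⟪x, ν⟫ ∈ [lo', lo' + R']`,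
`G = (W - α ν)/s'`, by Bessel's inequality for the orthonormal triple `(ν, B₀, G)`.  The planar count
`affine_sweptEllipse_count_upper` finishes.  When `α² = 1` the old bound is already uniform.

WHAT THIS IS NOT: the deficit bound itself is assembled in `…SampleDeficitUpperUnif.lean`; no packing
statement is touched here.
-/

noncomputable section

namespace Summit.Ventures.Crystal3D.Theorems

open InnerProductSpace Finset Matrix

/-- The real inner product on `EuclideanSpace ℝ (Fin 3)` is the dot product of the coordinate vectors. -/
theorem euclidean3_inner_eq_dotProduct (x y : EuclideanSpace ℝ (Fin 3)) :
    ⟪x, y⟫_ℝ = WithLp.ofLp x ⬝ᵥ WithLp.ofLp y := by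
  rw [EuclideanSpace.inner_eq_star_dotProduct]; simp [dotProduct_comm]

/-- Squared lateral distance from the axis `ℝ ν` (`‖ν‖ = 1`) is the squared norm of the projection
onto `ν^⊥`. -/
theorem lateral_sq_eq_norm_sub_sq (ν : EuclideanSpace ℝ (Fin 3)) (hν : ‖ν‖ = 1)
    (y : EuclideanSpace ℝ (Fin 3)) : ‖y‖ ^ 2 - ⟪y, ν⟫_ℝ ^ 2 = ‖y - ⟪y, ν⟫_ℝ • ν‖ ^ 2 := by
  rw [norm_sub_sq_real, real_inner_smul_right, norm_smul, hν, mul_one, Real.norm_eq_abs, sq_abs]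
  ring

/-- The lateral distance from the axis `ℝ ν` is `1`-Lipschitz:
`lat(x + e) ≤ lat(x) + ‖e‖`. -/
theorem sqrt_axialLateral_add_le (ν : EuclideanSpace ℝ (Fin 3)) (hν : ‖ν‖ = 1)
    (x e : EuclideanSpace ℝ (Fin 3)) :
    Real.sqrt (‖x + e‖ ^ 2 - ⟪x + e, ν⟫_ℝ ^ 2) ≤ Real.sqrt (‖x‖ ^ 2 - ⟪x, ν⟫_ℝ ^ 2) + ‖e‖ := by
  rw [lateral_sq_eq_norm_sub_sq ν hν, lateral_sq_eq_norm_sub_sq ν hν, Real.sqrt_sq (norm_nonneg _),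
    Real.sqrt_sq (norm_nonneg _)]
  have hsplit : x + e - ⟪x + e, ν⟫_ℝ • ν = (x - ⟪x, ν⟫_ℝ • ν) + (e - ⟪e, ν⟫_ℝ • ν) := by
    rw [inner_add_left, add_smul]; abel
  rw [hsplit]
  have he : ‖e - ⟪e, ν⟫_ℝ • ν‖ ≤ ‖e‖ := by
    have h1 : ‖e - ⟪e, ν⟫_ℝ • ν‖ ^ 2 ≤ ‖e‖ ^ 2 := by
      rw [← lateral_sq_eq_norm_sub_sq ν hν]; linarith [sq_nonneg ⟪e, ν⟫_ℝ]
    exact (abs_le_of_sq_le_sq' h1 (norm_nonneg e)).2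
  exact (norm_add_le _ _).trans (by linarith)

/-- Arithmetic for the degenerate case of `lineCount_upper_uniform`. -/
theorem lineCount_uniform_arith_one (ρ R : ℝ) (hρ : 0 ≤ ρ) (hR : 0 ≤ R) :
    Real.sqrt 2 * Real.pi * (ρ + (R / 2 + 4)) ^ 2 ≤
      Real.sqrt 2 * Real.pi * (ρ + 2) ^ 2 + 2 * Real.sqrt 2 * Real.pi * (ρ + R + 4) * (R + 4) := by
  have hkey : (ρ + (R / 2 + 4)) ^ 2 ≤ (ρ + 2) ^ 2 + 2 * ((ρ + R + 4) * (R + 4)) := by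
    nlinarith [mul_nonneg hρ hR]
  have h2π : 0 ≤ Real.sqrt 2 * Real.pi := by positivity
  have := mul_le_mul_of_nonneg_left hkey h2π
  linarith

/-- Arithmetic for the generic case of `lineCount_upper_uniform`. -/
theorem lineCount_uniform_arith_two (ρ R : ℝ) (hρ : 0 ≤ ρ) (hR : 0 ≤ R) :
    Real.sqrt 2 * (2 * (ρ + 2) * (R + 4)) ≤ 2 * Real.sqrt 2 * Real.pi * (ρ + R + 4) * (R + 4) := by
  have hπ2 : (2 : ℝ) ≤ Real.pi := Real.two_le_pi
  have h3 : (ρ + 2) ≤ Real.pi * (ρ + R + 4) := by nlinarith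
  have h4 : 0 ≤ 2 * (R + 4) := by linarith
  have h5 := mul_le_mul_of_nonneg_left h3 h4
  have h6 : 2 * (ρ + 2) * (R + 4) ≤ 2 * Real.pi * (ρ + R + 4) * (R + 4) := by linarith
  have h7 := mul_le_mul_of_nonneg_left h6 (Real.sqrt_nonneg 2)
  linarith

/-- **Uniform per-class line count.**  `ν, W` unit vectors with `α = ⟪W, ν⟫ ≠ 0`, `‖Ea‖, ‖Eb‖ ≤ 1`,
`det[Ea, Eb, W]² = 1/2`, `R, ρ ≥ 0`, and `T ⊆ ℤ²` finite such that for every `(a, b) ∈ T` some point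
`a Ea + b Eb + t W + s`, `t ∈ ℤ`, has height `⟪·, ν⟫ ∈ [lo, lo + R]` and squared lateral distance
`‖·‖² - ⟪·, ν⟫² ≤ ρ²`.  Then `#T ≤ √2 |α| π (ρ + 2)² + 2 √2 π (ρ + R + 4) (R + 4)` — a constant free of
`α`. -/
theorem lineCount_upper_uniform (ν : EuclideanSpace ℝ (Fin 3)) (hν : ‖ν‖ = 1)
    (R ρ lo : ℝ) (hR : 0 ≤ R) (hρ : 0 ≤ ρ) (Ea Eb W s : EuclideanSpace ℝ (Fin 3))
    (hEa : ‖Ea‖ ≤ 1) (hEb : ‖Eb‖ ≤ 1) (hW : ‖W‖ = 1)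
    (hdet : (Matrix.det ![WithLp.ofLp Ea, WithLp.ofLp Eb, WithLp.ofLp W]) ^ 2 = 1 / 2)
    (hα : ⟪W, ν⟫_ℝ ≠ 0) (T : Finset (ℤ × ℤ))
    (hT : ∀ p ∈ T, ∃ t : ℤ,
      lo ≤ ⟪(p.1 : ℝ) • Ea + (p.2 : ℝ) • Eb + (t : ℝ) • W + s, ν⟫_ℝ ∧
      ⟪(p.1 : ℝ) • Ea + (p.2 : ℝ) • Eb + (t : ℝ) • W + s, ν⟫_ℝ ≤ lo + R ∧
      ‖(p.1 : ℝ) • Ea + (p.2 : ℝ) • Eb + (t : ℝ) • W + s‖ ^ 2 -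
          ⟪(p.1 : ℝ) • Ea + (p.2 : ℝ) • Eb + (t : ℝ) • W + s, ν⟫_ℝ ^ 2 ≤ ρ ^ 2) :
    (T.card : ℝ) ≤ Real.sqrt 2 * |⟪W, ν⟫_ℝ| * Real.pi * (ρ + 2) ^ 2 +
      2 * Real.sqrt 2 * Real.pi * (ρ + R + 4) * (R + 4) := by
  have h2pos : 0 < Real.sqrt 2 := Real.sqrt_pos.2 (by norm_num)
  have h2sq : Real.sqrt 2 ^ 2 = 2 := Real.sq_sqrt (by norm_num)
  have hπ2 : (2 : ℝ) ≤ Real.pi := Real.two_le_pi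
  set α : ℝ := ⟪W, ν⟫_ℝ with hαdef
  have hαpos : 0 < |α| := abs_pos.2 hα
  have hνν : ⟪ν, ν⟫_ℝ = 1 := by rw [real_inner_self_eq_norm_sq, hν, one_pow]
  have hWW : ⟪W, W⟫_ℝ = 1 := by rw [real_inner_self_eq_norm_sq, hW, one_pow]
  have hνW : ⟪ν, W⟫_ℝ = α := by rw [hαdef, real_inner_comm]
  have hαle : |α| ≤ 1 := by
    have h := abs_real_inner_le_norm W ν; rw [hν, hW, mul_one] at h; exact h
  have hα2le : α ^ 2 ≤ 1 := by
    have := mul_le_one₀ hαle (abs_nonneg α) hαle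
    rw [← sq_abs]; nlinarith
  -- the degenerate case `α² = 1`: the old bound is uniform
  rcases hα2le.lt_or_eq with hα2lt | hα2eq
  swap
  · have habs : |α| = 1 := by
      have h1 : |α| ^ 2 = 1 ^ 2 := by rw [sq_abs, hα2eq, one_pow]
      exact (pow_left_inj₀ (abs_nonneg α) zero_le_one two_ne_zero).1 h1
    have hold := lineCount_upper_offset_window ν hν R ρ lo hR hρ Ea Eb W s hEa hEb hW hdet hα T hT
    rw [← hαdef, habs, div_one, mul_one] at hold
    rw [habs, mul_one]
    exact hold.trans (lineCount_uniform_arith_one ρ R hρ hR)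
  -- the generic case `α² < 1`
  set s' : ℝ := Real.sqrt (1 - α ^ 2) with hs'def
  have hs'pos : 0 < s' := Real.sqrt_pos.2 (by linarith)
  have hs'sq : s' ^ 2 = 1 - α ^ 2 := Real.sq_sqrt (by linarith)
  have hs'le : s' ≤ 1 := by
    rw [hs'def, Real.sqrt_le_one]; nlinarith
  have hs'ne : s' ≠ 0 := hs'pos.ne'
  have h1αα : 1 - α * α = s' * s' := by rw [← sq, ← sq, hs'sq]
  -- the frame `B₁ = (ν - α W)/s'`, `B₀ = B₁ × W`, `G = (W - α ν)/s'`
  set B1 : EuclideanSpace ℝ (Fin 3) := s'⁻¹ • (ν - α • W) with hB1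
  set G : EuclideanSpace ℝ (Fin 3) := s'⁻¹ • (W - α • ν) with hG
  set B0 : EuclideanSpace ℝ (Fin 3) :=
    WithLp.toLp 2 (crossProduct (WithLp.ofLp B1) (WithLp.ofLp W)) with hB0
  have hB1W : ⟪B1, W⟫_ℝ = 0 := by
    rw [hB1, real_inner_smul_left, inner_sub_left, real_inner_smul_left, hνW, hWW]; ring
  have hWB1 : ⟪W, B1⟫_ℝ = 0 := by rw [real_inner_comm, hB1W]
  have hB1ν : ⟪B1, ν⟫_ℝ = s' := by
    rw [hB1, real_inner_smul_left, inner_sub_left, real_inner_smul_left, hνν, ← hαdef, h1αα,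
      ← mul_assoc, inv_mul_cancel₀ hs'ne, one_mul]
  have hB1B1 : ⟪B1, B1⟫_ℝ = 1 := by
    have : ⟪B1, B1⟫_ℝ = s'⁻¹ * (⟪B1, ν⟫_ℝ - α * ⟪B1, W⟫_ℝ) := by
      conv_lhs => rw [hB1]
      rw [real_inner_smul_right, inner_sub_right, real_inner_smul_right]
    rw [this, hB1ν, hB1W, mul_zero, sub_zero, inv_mul_cancel₀ hs'ne]
  have hGν : ⟪G, ν⟫_ℝ = 0 := by
    rw [hG, real_inner_smul_left, inner_sub_left, real_inner_smul_left, hνν, ← hαdef]; ring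
  have hGW : ⟪G, W⟫_ℝ = s' := by
    rw [hG, real_inner_smul_left, inner_sub_left, real_inner_smul_left, hWW, hνW, h1αα,
      ← mul_assoc, inv_mul_cancel₀ hs'ne, one_mul]
  have hGG : ⟪G, G⟫_ℝ = 1 := by
    have : ⟪G, G⟫_ℝ = s'⁻¹ * (⟪G, W⟫_ℝ - α * ⟪G, ν⟫_ℝ) := by
      conv_lhs => rw [hG]
      rw [real_inner_smul_right, inner_sub_right, real_inner_smul_right]
    rw [this, hGW, hGν, mul_zero, sub_zero, inv_mul_cancel₀ hs'ne]
  -- dot-product versions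
  have dB1W : WithLp.ofLp B1 ⬝ᵥ WithLp.ofLp W = 0 := by
    rw [← euclidean3_inner_eq_dotProduct]; exact hB1W
  have dWB1 : WithLp.ofLp W ⬝ᵥ WithLp.ofLp B1 = 0 := by
    rw [← euclidean3_inner_eq_dotProduct]; exact hWB1
  have dB1B1 : WithLp.ofLp B1 ⬝ᵥ WithLp.ofLp B1 = 1 := by
    rw [← euclidean3_inner_eq_dotProduct]; exact hB1B1
  have dWW : WithLp.ofLp W ⬝ᵥ WithLp.ofLp W = 1 := by
    rw [← euclidean3_inner_eq_dotProduct]; exact hWW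
  -- facts about `B₀`
  have hB0of : WithLp.ofLp B0 = crossProduct (WithLp.ofLp B1) (WithLp.ofLp W) := by
    rw [hB0, WithLp.ofLp_toLp]
  have hB0W : ⟪B0, W⟫_ℝ = 0 := by
    rw [euclidean3_inner_eq_dotProduct, hB0of, dotProduct_comm]
    exact dot_cross_self _ _
  have hWB0 : ⟪W, B0⟫_ℝ = 0 := by rw [real_inner_comm, hB0W]
  have hB0B1 : ⟪B0, B1⟫_ℝ = 0 := by
    rw [euclidean3_inner_eq_dotProduct, hB0of, dotProduct_comm]
    exact dot_self_cross _ _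
  have hB0B0 : ⟪B0, B0⟫_ℝ = 1 := by
    rw [euclidean3_inner_eq_dotProduct, hB0of, cross_dot_cross, dB1B1, dWW, dB1W, dWB1]; ring
  have hB0ν : ⟪B0, ν⟫_ℝ = 0 := by
    -- `ν = s' B₁ + α W`
    have hν' : ν = s' • B1 + α • W := by
      rw [hB1, smul_smul, mul_inv_cancel₀ hs'ne, one_smul]; abel
    have : ⟪B0, ν⟫_ℝ = s' * ⟪B0, B1⟫_ℝ + α * ⟪B0, W⟫_ℝ := by
      rw [← real_inner_smul_right, ← real_inner_smul_right, ← inner_add_right, ← hν']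
    rw [this, hB0B1, hB0W]; ring
  have hνB0 : ⟪ν, B0⟫_ℝ = 0 := by rw [real_inner_comm, hB0ν]
  have hνG : ⟪ν, G⟫_ℝ = 0 := by rw [real_inner_comm, hGν]
  have hB0G : ⟪B0, G⟫_ℝ = 0 := by
    rw [hG, real_inner_smul_right, inner_sub_right, real_inner_smul_right, hB0W, hB0ν]; ring
  have hGB0 : ⟪G, B0⟫_ℝ = 0 := by rw [real_inner_comm, hB0G]
  have hB0cross : crossProduct (WithLp.ofLp B0) (WithLp.ofLp B1) = WithLp.ofLp W := by
    rw [hB0of, cross_cross_eq_smul_sub_smul, dB1B1, dWB1, one_smul, zero_smul, sub_zero]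
  -- unit norms
  have hB0n : ‖B0‖ = 1 := by
    have h1 : ‖B0‖ ^ 2 = 1 ^ 2 := by rw [← real_inner_self_eq_norm_sq, hB0B0, one_pow]
    exact (pow_left_inj₀ (norm_nonneg _) zero_le_one two_ne_zero).1 h1
  have hGn : ‖G‖ = 1 := by
    have h1 : ‖G‖ ^ 2 = 1 ^ 2 := by rw [← real_inner_self_eq_norm_sq, hGG, one_pow]
    exact (pow_left_inj₀ (norm_nonneg _) zero_le_one two_ne_zero).1 h1
  -- the planar lattice of feet
  set A' : Matrix (Fin 2) (Fin 2) ℝ := !![⟪Ea, B0⟫_ℝ, ⟪Eb, B0⟫_ℝ; ⟪Ea, B1⟫_ℝ, ⟪Eb, B1⟫_ℝ] with hA'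
  set β : Fin 2 → ℝ := ![⟪s, B0⟫_ℝ, ⟪s, B1⟫_ℝ] with hβ
  have hA'det : A'.det = Matrix.det ![WithLp.ofLp Ea, WithLp.ofLp Eb, WithLp.ofLp W] := by
    rw [hA', Matrix.det_fin_two_of, euclidean3_inner_eq_dotProduct, euclidean3_inner_eq_dotProduct,
      euclidean3_inner_eq_dotProduct, euclidean3_inner_eq_dotProduct]
    have h := cross_dot_cross (WithLp.ofLp Ea) (WithLp.ofLp Eb) (WithLp.ofLp B0) (WithLp.ofLp B1)
    rw [hB0cross] at h
    have h' : WithLp.ofLp W ⬝ᵥ crossProduct (WithLp.ofLp Ea) (WithLp.ofLp Eb) =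
        WithLp.ofLp Ea ⬝ᵥ WithLp.ofLp B0 * WithLp.ofLp Eb ⬝ᵥ WithLp.ofLp B1 -
          WithLp.ofLp Ea ⬝ᵥ WithLp.ofLp B1 * WithLp.ofLp Eb ⬝ᵥ WithLp.ofLp B0 := by
      rw [dotProduct_comm]; exact h
    rw [triple_product_permutation, triple_product_eq_det] at h'
    rw [h']; ring
  have hA'det0 : A'.det ≠ 0 := by
    intro h0; rw [hA'det] at h0; rw [h0] at hdet; norm_num at hdet
  have hA'abs : Real.sqrt 2 * |A'.det| = 1 := by
    have h1 : (Real.sqrt 2 * |A'.det|) ^ 2 = 1 ^ 2 := by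
      rw [mul_pow, h2sq, sq_abs, hA'det, hdet]; norm_num
    exact (pow_left_inj₀ (by positivity) zero_le_one two_ne_zero).1 h1
  have hmv0 : ∀ v : Fin 2 → ℝ, A'.mulVec v 0 = ⟪Ea, B0⟫_ℝ * v 0 + ⟪Eb, B0⟫_ℝ * v 1 := by
    intro v; simp [hA', Matrix.mulVec, dotProduct, Fin.sum_univ_two]
  have hmv1 : ∀ v : Fin 2 → ℝ, A'.mulVec v 1 = ⟪Ea, B1⟫_ℝ * v 0 + ⟪Eb, B1⟫_ℝ * v 1 := by
    intro v; simp [hA', Matrix.mulVec, dotProduct, Fin.sum_univ_two]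
  -- Bessel for the orthonormal triple `(ν, B₀, G)`
  have hON : Orthonormal ℝ ![ν, B0, G] := by
    refine ⟨fun i => ?_, fun i j hij => ?_⟩
    · fin_cases i
      · simpa using hν
      · simpa using hB0n
      · simpa using hGn
    · fin_cases i <;> fin_cases j <;> first
        | exact absurd rfl hij
        | simpa using hνB0 | simpa using hνG | simpa using hB0ν | simpa using hB0G
        | simpa using hGν | simpa using hGB0
  have hBessel : ∀ x : EuclideanSpace ℝ (Fin 3),
      ⟪x, ν⟫_ℝ ^ 2 + ⟪x, B0⟫_ℝ ^ 2 + ⟪x, G⟫_ℝ ^ 2 ≤ ‖x‖ ^ 2 := by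
    intro x
    have h := hON.sum_inner_products_le x (s := Finset.univ)
    simp only [Fin.sum_univ_three, Matrix.cons_val_zero, Matrix.cons_val_one,
      Matrix.cons_val, Real.norm_eq_abs, sq_abs] at h
    rw [real_inner_comm x ν, real_inner_comm x B0, real_inner_comm x G] at h
    exact h
  -- the count
  have hcount := affine_sweptEllipse_count_upper A' hA'det0 β |α| s' (ρ + 2) (lo - 2) (R + 4)
    hαpos hs'pos.le hs'le (by linarith) (by linarith) T ?_
  · -- arithmetic
    have hT' : (T.card : ℝ) = Real.sqrt 2 * (|A'.det| * (T.card : ℝ)) := by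
      rw [← mul_assoc, hA'abs, one_mul]
    rw [hT']
    have h1 : Real.sqrt 2 * (|A'.det| * (T.card : ℝ)) ≤
        Real.sqrt 2 * (|α| * Real.pi * (ρ + 2) ^ 2 + 2 * (ρ + 2) * (R + 4)) :=
      mul_le_mul_of_nonneg_left hcount h2pos.le
    have h5 := lineCount_uniform_arith_two ρ R hρ hR
    have h6 : Real.sqrt 2 * (|α| * Real.pi * (ρ + 2) ^ 2 + 2 * (ρ + 2) * (R + 4)) =
        Real.sqrt 2 * |α| * Real.pi * (ρ + 2) ^ 2 + Real.sqrt 2 * (2 * (ρ + 2) * (R + 4)) := by ring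
    rw [h6] at h1
    exact h1.trans (by linarith)
  -- every cell lies in the swept ellipse with parameters `(ρ + 2, lo - 2, R + 4)`
  intro p hp f hf
  obtain ⟨t, hlo, hhi, hlat0⟩ := hT p hp
  obtain ⟨x, hx⟩ : ∃ x : EuclideanSpace ℝ (Fin 3),
      x = (p.1 : ℝ) • Ea + (p.2 : ℝ) • Eb + (t : ℝ) • W + s := ⟨_, rfl⟩
  obtain ⟨e, he⟩ : ∃ e : EuclideanSpace ℝ (Fin 3), e = f 0 • Ea + f 1 • Eb := ⟨_, rfl⟩
  rw [← hx] at hlo hhi hlat0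
  have henorm : ‖e‖ ≤ 2 := by
    have h0 : ‖f 0 • Ea‖ ≤ 1 := by
      rw [norm_smul, Real.norm_eq_abs, abs_of_nonneg (hf 0).1]
      exact mul_le_one₀ (hf 0).2.le (norm_nonneg _) hEa
    have h1 : ‖f 1 • Eb‖ ≤ 1 := by
      rw [norm_smul, Real.norm_eq_abs, abs_of_nonneg (hf 1).1]
      exact mul_le_one₀ (hf 1).2.le (norm_nonneg _) hEb
    rw [he]; exact (norm_add_le _ _).trans (by linarith)
  have heν : |⟪e, ν⟫_ℝ| ≤ 2 := by
    have h := abs_real_inner_le_norm e ν; rw [hν, mul_one] at h; exact h.trans henorm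
  -- the feet coordinates of the cell point are those of `x + e`
  have hfeet0 : A'.mulVec (![(p.1 : ℝ), (p.2 : ℝ)] + f) 0 + β 0 = ⟪x + e, B0⟫_ℝ := by
    rw [hmv0, hβ, hx, he]
    simp only [inner_add_left, real_inner_smul_left, hWB0, Pi.add_apply, Matrix.cons_val_zero,
      Matrix.cons_val_one]
    ring
  have hfeet1 : A'.mulVec (![(p.1 : ℝ), (p.2 : ℝ)] + f) 1 + β 1 = ⟪x + e, B1⟫_ℝ := by
    rw [hmv1, hβ, hx, he]
    simp only [inner_add_left, real_inner_smul_left, hWB1, Pi.add_apply, Matrix.cons_val_zero,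
      Matrix.cons_val_one]
    ring
  refine ⟨⟪x + e, ν⟫_ℝ, ?_, ?_, ?_⟩
  · rw [inner_add_left]; linarith [(abs_le.1 heν).1]
  · rw [inner_add_left]; linarith [(abs_le.1 heν).2]
  · rw [hfeet0, hfeet1]
    -- `⟪y, B₁⟫ - ⟪y, ν⟫ s' = -α ⟪y, G⟫`
    have hB1G : B1 - s' • ν = (-α) • G := by
      have h1 : s' • B1 = ν - α • W := by rw [hB1, smul_smul, mul_inv_cancel₀ hs'ne, one_smul]
      have h2 : s' • G = W - α • ν := by rw [hG, smul_smul, mul_inv_cancel₀ hs'ne, one_smul]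
      refine smul_right_injective (EuclideanSpace ℝ (Fin 3)) hs'ne ?_
      show s' • (B1 - s' • ν) = s' • ((-α) • G)
      rw [smul_sub, h1, smul_comm s' (-α) G, h2, smul_smul, ← sq, hs'sq]
      module
    have hrot : ⟪x + e, B1⟫_ℝ - ⟪x + e, ν⟫_ℝ * s' = -α * ⟪x + e, G⟫_ℝ := by
      rw [show ⟪x + e, ν⟫_ℝ * s' = s' * ⟪x + e, ν⟫_ℝ from mul_comm _ _,
        ← real_inner_smul_right (x + e) ν, ← inner_sub_right, hB1G, real_inner_smul_right]
    rw [hrot, sq_abs]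
    have hB := hBessel (x + e)
    have hl : Real.sqrt (‖x + e‖ ^ 2 - ⟪x + e, ν⟫_ℝ ^ 2) ≤ ρ + 2 := by
      have h1 := sqrt_axialLateral_add_le ν hν x e
      have h2 : Real.sqrt (‖x‖ ^ 2 - ⟪x, ν⟫_ℝ ^ 2) ≤ ρ := by
        rw [← Real.sqrt_sq hρ]; exact Real.sqrt_le_sqrt hlat0
      linarith
    have hl2 : ‖x + e‖ ^ 2 - ⟪x + e, ν⟫_ℝ ^ 2 ≤ (ρ + 2) ^ 2 := by
      have hnn : 0 ≤ ‖x + e‖ ^ 2 - ⟪x + e, ν⟫_ℝ ^ 2 := by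
        rw [lateral_sq_eq_norm_sub_sq ν hν]; positivity
      rw [← Real.sq_sqrt hnn]
      exact pow_le_pow_left₀ (Real.sqrt_nonneg _) hl 2
    have hbg : ⟪x + e, B0⟫_ℝ ^ 2 + ⟪x + e, G⟫_ℝ ^ 2 ≤ (ρ + 2) ^ 2 := by linarith
    have hsc := mul_le_mul_of_nonneg_left hbg (sq_nonneg α)
    have hex : α ^ 2 * ⟪x + e, B0⟫_ℝ ^ 2 + (-α * ⟪x + e, G⟫_ℝ) ^ 2 =
        α ^ 2 * (⟪x + e, B0⟫_ℝ ^ 2 + ⟪x + e, G⟫_ℝ ^ 2) := by ring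
    rw [hex]
    exact hsc

end Summit.Ventures.Crystal3D.Theorems

end
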